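import Mathlib
import HarnessLib
import Summits.HubbardSuperconductivity.HubbardSuperconductivity.Theorems.KLProgrammeKLRegimeEngineTowerPartialIncrWtKit
import Summits.HubbardSuperconductivity.HubbardSuperconductivity.Theorems.KLProgrammeKLRegimeEngineTowerWtReadoutRo
import Summits.HubbardSuperconductivity.HubbardSuperconductivity.Theorems.KLProgrammeKLRegimeEngineTowerWtStepLinkKlEng
import Summits.HubbardSuperconductivity.HubbardSuperconductivity.Theorems.KLProgrammeKLRegimeEngineTowerLevReadoutIncrJump

/-!
# Route `KLProgramme` — crux K3 ENGINE (stmt-HubbardSuperconductivity-20437 `KLRegimeEngineV17F2`), stub (b) v2, THE WEIGHTED HALF «(b)-WT4»: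
# W7a — THE WEIGHTED READ-OUT, INCREMENT PART (RO-2ʷ): the partial-block increment `𝒱_j − 𝒱_{dK_b}` at the PUBLIC family `(F_j, rate j)` in floor units,
# bounded by the law's kit bracket at block `K_b`, ON THE FLOW FRAME with the partial slice's data discharged
# (cell gate-hubbard-kl, seat hubbard-kl-k3c3-p2 g17; p3 g22's WB1 `klWtPinnedSumAt_partialIncr_le_kitStep_of_bounds` (…TowerPartialIncrWtKit, p700129) at the
#  BORN family `F_{dK_b}` ∘ ONE weighted jump `F_{dK_b} → F_j` (p4 g17's m-uniform row); levelled counterpart = this lineage's RO-4″/RO-4‴ (g16); E1 may rename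
#  or supersede)

The partial increment is born from the block input `𝒱_{dK_b}` (read at `F̃_{dK_b−1}`) by the PARTIAL slice `(Λ_j, Λ_{dK_b}]`; WB1 reads it at the born family
`F_{dK_b}` — where the analysis overlaps `E(F_{dK_b})·S(F̃_{dK_b−1})` are the SAME as block `K_b`'s LINK (so the kit parameters `W Z σ τ ψ Φ` are the law's and
the law's exported guard applies) — and one weighted jump moves it to `F_j` at the pure-gain cost `(C₁/C₂)(C₂²)^p` in floor units (`jumpW_mul_div_klLevUnitF_le`).
The slice's Gram constant is the block's (`gram_sliceCT_bgmFat_sharp_klEng` is Λ-generic: `κ² = Cκ·(Λ_{dK_b}/Λ_{dK_b−1})·e₀·8^{−(dK_b−1)}`), its weighted decay rows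
come from `alphaWt_blockSliceCT_bgmFat_klEng_flow_all' (db := d)` (`α ≤ Cb′(M/β)/Λ_j ≤ (Cb′(M/β)4^d/e₀)·4^{dK_b}` for `j ≤ dK_b + d`), so every k-free bound is a
DOMINANT of the suppliers' constants exactly as in W5 — the assembly takes `κ̄ ᾱ c̄r c̄c` above both the law's and the read-out's constants.
* §1 `klWtPinnedSumAt_zero_elem` (the zero element has zero weighted sizes), `div_klScale_le_bound_mul_pow` (`x/Λ_j ≤ (x·4^d/e₀)·4^{dk}` for `j ≤ dk + d`);
* §2 **`wtJump_readout_le_klEng (R c″)`** — ON `K_n`: a floor-unit bound `N` of ALL rate-`j` weighted pinned sums of a conserving `T` at `F_J` gives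
  `(…at F_{J′}…)/klLevUnitF β M 0 p J′ ≤ (C₁/C₂)·(C₂²)^p·N` for `J + 1 ≤ J′ ≤ n`, `J′ ≤ j`, `3 ≤ p` (twin of `floorJump_readout_le` at track `0`, no `27`);
* §3 **`readoutWt_inc_le_kit_klEng (d R c″)`** — `∃ Cκ′ Cb′ CJ′ C₁ C₂ > 0`, `R.WF2 → ∃ c₃′ U₀′`: on `K_n`, `2 ≤ d`, `1 ≤ K_b`, `d·K_b ≤ j ≤ n`, `j ≤ d·K_b + d`, cap at
  block `K_b`, `Z^{K_n}_{Λ_{dK_b}} ≠ 0`, dominants `κ̄ ᾱ c̄r c̄c`, names `W Z σ τ ψ Φ` as in W2/W5: for every `N ≥ 1`, degree `2(q+1)` and the law's guard at block `K_b`,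
  every pin at `F_j` (`q ≥ 2`): `klWtPinnedSumAt … j j (2(q+1)) (𝒱_j − 𝒱_{dK_b}) i w / klLevUnitF β M 0 (q+1) j ≤ (C₁/C₂)·(max 1 C₂²)^{q+1}·kit(μ̄_{K_b}; σ, τ, Φ, ψ; N)`.
Compositions of landed theorems; nothing about the model is asserted beyond them; nothing asserts (b), (ℓ), any stub, K3 or superconductivity.
References: BGM 2006 §2.8 (2.76)–(2.84), (2.93)–(2.98), §3 (3.2)–(3.8) [cite: BenfattoGiulianiMastropietro2006].
-/

noncomputable section

namespace Summit.HubbardSuperconductivity.HubbardSuperconductivity.Theorems.EngineV8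

set_option linter.dupNamespace false -- summit = problem name (single-conjunct summit), D-0017

open Classical
open Real Finset Literature.MathematicalPhysics.QuantumLattice Literature.Probability.LatticeModels GrassmannAlgebra
open Literature.MathematicalPhysics.QuantumLattice.FermiRG Literature.MathematicalPhysics.QuantumLattice.FermiRG.BGM2006Routing
open Summit.HubbardSuperconductivity.HubbardSuperconductivity.Theorems.KLProgrammeLegKernels
open Summit.HubbardSuperconductivity.HubbardSuperconductivity.Theorems.KLRegimeSplit
open Summit.HubbardSuperconductivity.HubbardSuperconductivity.Theorems.KLRegimeWick
open Summit.HubbardSuperconductivity.HubbardSuperconductivity.Theorems.TwoPointAssembly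
open Summit.HubbardSuperconductivity.HubbardSuperconductivity.Theorems.DispersionFlow
open Summit.HubbardSuperconductivity.HubbardSuperconductivity.Theorems.TorusFourierL2

variable {L M : ℕ} [NeZero L] [NeZero M]

/-! ## §1 Two small rows -/

omit [NeZero M] in
/-- The zero element has zero weighted pinned sums. -/
theorem klWtPinnedSumAt_zero_elem (β μ : ℝ) (K : TrigPolyC4v) (J j m : ℕ) (q : Fin m) (w : SpaceTimeIdx L M × SectorLeg (sectorCount J)) :
    klWtPinnedSumAt L M β μ K J j m 0 q w = 0 := by
  unfold klWtPinnedSumAt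
  refine mul_eq_zero_of_right _ (sum_eq_zero fun X _ => ?_)
  rw [map_zero, kernel_zero_right, norm_zero, mul_zero]

omit [NeZero L] [NeZero M] in
/-- **The partial slice's decay bound at the block's k-free shape**: for `x ≥ 0` and `j ≤ dk + d`, `x / Λ_j ≤ (x·4^d/e₀)·4^{dk}`. -/
theorem div_klScale_le_bound_mul_pow {x : ℝ} (hx : 0 ≤ x) {d k j : ℕ} (hj : j ≤ d * k + d) :
    x / klScale klE0 j ≤ x * (4 : ℝ) ^ d / klE0 * (4 : ℝ) ^ (d * k) := by
  have he : (0 : ℝ) < klE0 := by norm_num [klE0]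
  have h1 : klScale klE0 (d * (k + 1)) ≤ klScale klE0 j := klScale_le_klScale he.le (by rw [Nat.mul_succ]; exact hj)
  have h2 : 0 < klScale klE0 (d * (k + 1)) := klth_klScale_pos _
  calc x / klScale klE0 j ≤ x / klScale klE0 (d * (k + 1)) := div_le_div_of_nonneg_left hx h2 h1
    _ = x * (4 : ℝ) ^ d / klE0 * (4 : ℝ) ^ (d * k) := by
        unfold klScale
        rw [Nat.mul_succ, pow_add]
        field_simp

/-! ## §2 One weighted jump in floor units on the flow frame -/

omit [NeZero L] [NeZero M] in
/-- **A FLOOR-UNIT BOUND BORN AT `F_J` READ AT A FINER `F_{J′}`, weighted track, ON `K_n`** (`J + 1 ≤ J′ ≤ n`, rate `j ≥ J′`, `3 ≤ p`): for every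
momentum-conserving `T`, if ALL rate-`j` weighted pinned sums of `T` at `F_J` are `≤ N·klLevUnitF β M 0 p J` (`N ≥ 0`), then every rate-`j` weighted pinned sum at
`F_{J′}` divided by `klLevUnitF β M 0 p J′` is `≤ (C₁/C₂)·(C₂²)^p·N` — the jump factor `(2^{J′−J})^{2p−2}` against the unit ratio is the pure gain
`((2^{p−3})⁻¹)^{J′−J} ≤ 1`. [cite: BenfattoGiulianiMastropietro2006, §2.8 (2.82)-(2.84), (2.88)-(2.90)] -/
theorem wtJump_readout_le_klEng (R : RenConsts) (c'' : ℝ) (hc'' : 0 ≤ c'') :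
    ∃ C₁ C₂ : ℝ, 0 < C₁ ∧ 0 < C₂ ∧ (R.WF2 → ∃ c₃' : ℝ, 0 < c₃' ∧ ∃ U₀' : ℝ, 0 < U₀' ∧
      ∀ (G : GeoConsts) (P : SplitConsts) (Q : EngConsts) (cc : ℝ), 0 < cc → cc ≤ klEngC₃6 P R → cc ≤ c₃' →
      ∀ μ ∈ klWindowC, ∀ U : ℝ, 0 < U → U ≤ min (klEngU₀3 P R cc) (1 / (R.Gfr 3 + 1)) → U ≤ U₀' → c'' * U ≤ 1 →
      ∀ β : ℝ, klBetaMin ≤ β → β ≤ Real.exp (cc / U ^ 2) →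
      ∀ (L M : ℕ) [NeZero L] [NeZero M], klEngL₃ β U ≤ L → klEngM₃ β U L ≤ M →
      ∀ n : ℕ, 1 ≤ n → n ≤ nScales β + 1 → IsKLRegime U cc (-(n : ℤ)) → HistP klPredsV17F2 L M G P Q R β U μ 0 n →
        (∀ m', 1 ≤ m' → m' < n → FlowPieceOscAt L M c'' β U μ m') →
      ∀ J J' : ℕ, J + 1 ≤ J' → J' ≤ n → ∀ T : HubbardGrassmann L M,
        (∀ (m' : ℕ) (X : Fin m' → HubbardFieldIdx L M), ∑ i, signedMomentum L (X i).2 (X i).1.1.2 ≠ 0 → kernel ℂ T m' X = 0) →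
      ∀ j : ℕ, J' ≤ j → ∀ p : ℕ, 3 ≤ p → ∀ N : ℝ, 0 ≤ N →
        (∀ (q : Fin (2 * p)) (w' : SpaceTimeIdx L M × SectorLeg (sectorCount J)),
          klWtPinnedSumAt L M β μ (klFlowFrameU L M β U μ n) J j (2 * p) T q w' / klLevUnitF β M 0 p J ≤ N) →
        ∀ (q : Fin (2 * p)) (w : SpaceTimeIdx L M × SectorLeg (sectorCount J')),
          klWtPinnedSumAt L M β μ (klFlowFrameU L M β U μ n) J' j (2 * p) T q w / klLevUnitF β M 0 p J' ≤ C₁ / C₂ * (C₂ ^ 2) ^ p * N) := by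
  obtain ⟨C₁, C₂, hC₁, hC₂, h⟩ := klWtPinnedSumAt_jump_le_klEng_flow_all_uniform R c'' hc''
  refine ⟨C₁, C₂, hC₁, hC₂, fun hR2 => ?_⟩
  obtain ⟨c₃, hc₃, U₀, hU₀, h'⟩ := h hR2
  refine ⟨c₃, hc₃, U₀, hU₀, ?_⟩
  intro G P Q cc hcc hcc6 hcc₃' μ hμ U hU hUle hU₀' hcU β hβmin hβc L M _ _ hL3 hM3 n hn1 hnN hkl hhist hosc J J' hJ hJn T hT j hjJ p hp N hN0 hN q w
  have hβ : 0 < β := KLRegimeSplit.pos_of_klBetaMin_le hβmin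
  set K : TrigPolyC4v := klFlowFrameU L M β U μ n with hK
  have huJ : 0 < klLevUnitF β M 0 p J := klLevUnitF_pos hβ 0 p J
  have huJ' : 0 < klLevUnitF β M 0 p J' := klLevUnitF_pos hβ 0 p J'
  -- the absolute bound at the born family
  set N₀ : ℝ := N * klLevUnitF β M 0 p J with hN₀
  have hN₀0 : 0 ≤ N₀ := by positivity
  have hjump₀ := h' (2 * p - 1) G P Q cc hcc hcc6 hcc₃' μ hμ U hU hUle hU₀' hcU β hβmin hβc L M hL3 hM3 n hn1 hnN hkl hhist hosc J J' hJ hJn T hT j hjJ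
  rw [show 2 * p - 1 + 1 = 2 * p by omega, show 2 * p - 1 - 1 = 2 * p - 2 by omega] at hjump₀
  have hjump := hjump₀ q w N₀ hN₀0 (fun w' => (div_le_iff₀ huJ).1 (hN q w'))
  have hC : C₁ * C₂ ^ (2 * p - 1) = C₁ / C₂ * (C₂ ^ 2) ^ p := by
    have hpw : (C₂ ^ 2) ^ p = C₂ ^ (2 * p - 1) * C₂ := by
      rw [← pow_mul, ← pow_succ]; congr 1; omega
    rw [hpw]
    field_simp
  calc klWtPinnedSumAt L M β μ K J' j (2 * p) T q w / klLevUnitF β M 0 p J'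
      ≤ C₁ * C₂ ^ (2 * p - 1) * ((2 : ℝ) ^ (J' - J)) ^ (2 * p - 2) * N₀ / klLevUnitF β M 0 p J' := div_le_div_of_nonneg_right hjump huJ'.le
    _ = C₁ * C₂ ^ (2 * p - 1) * (((2 : ℝ) ^ (J' - J)) ^ (2 * p - 2) * N₀ / klLevUnitF β M 0 p J') := by ring
    _ ≤ C₁ * C₂ ^ (2 * p - 1) * (N₀ / klLevUnitF β M 0 p J) :=
        mul_le_mul_of_nonneg_left (jumpW_mul_div_klLevUnitF_le (M := M) hβ (by omega) hp hN₀0) (by positivity)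
    _ = C₁ / C₂ * (C₂ ^ 2) ^ p * N := by rw [hN₀, mul_div_assoc, div_self huJ.ne', mul_one, hC]

/-! ## §3 The partial increment at the public family under the law's kit bracket, on the flow frame -/

/-- **THE PARTIAL INCREMENT AT THE PUBLIC FAMILY UNDER THE LAW's KIT BRACKET, DATA DISCHARGED** (RO-2ʷ on `K_n`; see the module docstring): with
`μ̄ m = W·Z^m·klTowerMeasWtAt … d K_b j (2m)/klLevUnitF β M 0 m (dK_b−1)` and the names of W2/W5, for every `N ≥ 1`, degree `2(q+1)`, under the law's guard
`Φ·towerV D τ μ̄ < 1`, at every pin of `F_j`: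
`klWtPinnedSumAt … j j (2(q+1)) (𝒱_j − 𝒱_{dK_b}) i w / klLevUnitF β M 0 (q+1) j ≤ (C₁/C₂)·(max 1 C₂²)^{q+1}·[towerFO D σ μ̄ (q+1) + Σ_{n′∈[2,N]} e·Φ^{n′−1}·ψ^{q+1}·
towerS D τ μ̄ n′ (q+1) + ψ^{q+1}·e·V·(ΦV)^N/(1−ΦV)]`. [cite: BenfattoGiulianiMastropietro2006, §2.8 (2.76)-(2.84), (2.93)-(2.98), §3 (3.2)-(3.8)] -/
theorem readoutWt_inc_le_kit_klEng (d : ℕ) (R : RenConsts) (c'' : ℝ) (hc'' : 0 < c'') :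
    ∃ Cκ Cb CJ C₁ C₂ : ℝ, 0 < Cκ ∧ 0 < Cb ∧ 0 < CJ ∧ 0 < C₁ ∧ 0 < C₂ ∧ (R.WF2 → ∃ c₃' : ℝ, 0 < c₃' ∧ ∃ U₀' : ℝ, 0 < U₀' ∧
      ∀ (G : GeoConsts) (P : SplitConsts) (Q : EngConsts) (c : ℝ), P.WF → 0 < c → c ≤ klEngC₃6 P R → c ≤ c₃' →
      ∀ μ ∈ klWindowC, ∀ U : ℝ, 0 < U → U ≤ klEngU₀9 P R c → U ≤ U₀' → c'' * U ≤ 1 →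
      ∀ β : ℝ, klBetaMin ≤ β → β ≤ Real.exp (c / U ^ 2) →
      ∀ (L M : ℕ) [NeZero L] [NeZero M], klEngL₃ β U ≤ L → klEngM₃ β U L ≤ M →
      ∀ n : ℕ, 1 ≤ n → n ≤ nScales β + 1 → IsKLRegime U c (-(n : ℤ)) → HistP klPredsV17F2 L M G P Q R β U μ 0 n →
        (∀ m', 1 ≤ m' → m' < n → FlowPieceOscAt L M c'' β U μ m') →
      2 ≤ d → ∀ Kb j : ℕ, 1 ≤ Kb → d * Kb ≤ j → j ≤ n → j ≤ d * Kb + d →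
      ∀ D : ℕ, Fintype.card (SpaceTimeIdx L M × SectorLeg (sectorCount (d * Kb - 1))) / 2 ≤ D →
      hubbardEffPartitionFnCT L M β U μ 0 (klFlowFrameU L M β U μ n) (klScale klE0 (d * Kb)) ≠ 0 →
      ∀ (κb αb crb ccb : ℝ), Real.sqrt (2 * Cκ * klE0) ≤ κb → Cb * ((M : ℝ) / β) * (4 : ℝ) ^ d / klE0 ≤ αb →
        81 * CJ * M / β ≤ crb → 162 * CJ * M / β ≤ ccb →
      ∀ (W Z σ τ ψ Φ : ℝ),
        W = 32 * crb / ccb → Z = imagTimeWeight β M ^ 2 * ccb ^ 2 / 8 →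
        σ = κb ^ 2 / ccb ^ 2 → τ = 4 * exp 4 * κb ^ 2 / ccb ^ 2 → ψ = ccb ^ 2 / κb ^ 2 → Φ = exp 1 * αb * ccb / (κb ^ 2 * crb) →
      ∀ N : ℕ, 1 ≤ N → ∀ q : ℕ, 2 ≤ q →
        Φ * towerV D τ (fun m => W * Z ^ m *
          (klTowerMeasWtAt L M β U μ (klFlowFrameU L M β U μ n) d Kb j (2 * m) / klLevUnitF β M 0 m (d * Kb - 1))) < 1 →
        ∀ (i : Fin (2 * (q + 1))) (w : SpaceTimeIdx L M × SectorLeg (sectorCount j)),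
        klWtPinnedSumAt L M β μ (klFlowFrameU L M β U μ n) j j (2 * (q + 1))
            (klEffectiveAction L M β U μ (klFlowFrameU L M β U μ n) klE0 j - klTowerInput L M β U μ (klFlowFrameU L M β U μ n) d Kb) i w /
            klLevUnitF β M 0 (q + 1) j ≤
          C₁ / C₂ * (max 1 (C₂ ^ 2)) ^ (q + 1) *
            (towerFO D σ (fun m => W * Z ^ m *
                (klTowerMeasWtAt L M β U μ (klFlowFrameU L M β U μ n) d Kb j (2 * m) / klLevUnitF β M 0 m (d * Kb - 1))) (q + 1) +
              ∑ n' ∈ Icc 2 N, exp 1 * Φ ^ (n' - 1) * ψ ^ (q + 1) *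
                towerS D τ (fun m => W * Z ^ m *
                  (klTowerMeasWtAt L M β U μ (klFlowFrameU L M β U μ n) d Kb j (2 * m) / klLevUnitF β M 0 m (d * Kb - 1))) n' (q + 1) +
              ψ ^ (q + 1) * exp 1 * towerV D τ (fun m => W * Z ^ m *
                  (klTowerMeasWtAt L M β U μ (klFlowFrameU L M β U μ n) d Kb j (2 * m) / klLevUnitF β M 0 m (d * Kb - 1))) *
                (Φ * towerV D τ (fun m => W * Z ^ m *
                  (klTowerMeasWtAt L M β U μ (klFlowFrameU L M β U μ n) d Kb j (2 * m) / klLevUnitF β M 0 m (d * Kb - 1)))) ^ N /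
                (1 - Φ * towerV D τ (fun m => W * Z ^ m *
                  (klTowerMeasWtAt L M β U μ (klFlowFrameU L M β U μ n) d Kb j (2 * m) / klLevUnitF β M 0 m (d * Kb - 1)))))) := by
  obtain ⟨Cκ, hCκ, hg⟩ := gram_sliceCT_bgmFat_sharp_klEng
  obtain ⟨Cb, hCb, hαp⟩ := alphaWt_blockSliceCT_bgmFat_klEng_flow_all' d R c'' hc''
  obtain ⟨CJ, hCJ, hop⟩ := overlapWt_towerBlock_klEng_flow_all d R c'' hc''.le
  obtain ⟨C₁, C₂, hC₁, hC₂, hjp⟩ := wtJump_readout_le_klEng R c'' hc''.le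
  refine ⟨Cκ, Cb, CJ, C₁, C₂, hCκ, hCb, hCJ, hC₁, hC₂, fun hR2 => ?_⟩
  obtain ⟨c₃, hc₃, U₀, hU₀, hjp'⟩ := hjp hR2
  refine ⟨c₃, hc₃, U₀, hU₀, ?_⟩
  intro G P Q c hP hc hc6 hc₃' μ hμ U hU hU9 hU₀' hcU β hβmin hβc L M _ _ hL3 hM3 n hn1 hnN hkl hhist hosc hd Kb j hKb1 hKbj hjn hjd D hD hZ
    κb αb crb ccb hκb hαb hcrb hccb W Z σ τ ψ Φ hW hZ' hσ hτ hψ hΦ N hN q hq2 hguard i w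
  have he : (0 : ℝ) < klE0 := by norm_num [klE0]
  have hβ : 0 < β := KLRegimeSplit.pos_of_klBetaMin_le hβmin
  have hM0 : (0 : ℝ) < M := Nat.cast_pos.2 (Nat.pos_of_ne_zero (NeZero.ne M))
  have hx : 0 < imagTimeWeight β M := imagTimeWeight_pos_of_pos (M := M) hβ
  have hfr : FrameOK R U (nScales β) μ (klFlowFrameU L M β U μ n) := frameOK_klFlowFrameU_of_histP_le hR2 hn1 le_rfl hnN hhist
  have hU4 : U ≤ klEngU₀4 P R c := hU9.trans (klEngU₀9_le_klEngU₀4 P R c)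
  have hU3g : U ≤ min (klEngU₀3 P R c) (1 / (R.Gfr 3 + 1)) :=
    le_min (hU9.trans (klEngU₀9_le_klEngU₀3 P R c)) (hU9.trans (klEngU₀9_le_inv_gfr_add_one P hR2.wf c (by norm_num)))
  have hc3 : c ≤ klEngC₃3 P R := hc6.trans (klEngC₃6_le_klEngC₃3 P R)
  set K : TrigPolyC4v := klFlowFrameU L M β U μ n with hKdef
  -- constants
  have hsq0 : 0 < Real.sqrt (2 * Cκ * klE0) := Real.sqrt_pos.2 (by positivity)
  have hκb0 : 0 < κb := lt_of_lt_of_le hsq0 hκb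
  have hαb0 : 0 < αb := lt_of_lt_of_le (by positivity) hαb
  have hcrb0 : 0 < crb := lt_of_lt_of_le (by positivity) hcrb
  have hccb0 : 0 < ccb := lt_of_lt_of_le (by positivity) hccb
  have hW0 : 0 < W := by rw [hW]; positivity
  have hZ0 : 0 < Z := by rw [hZ']; positivity
  have hσ0 : 0 ≤ σ := by rw [hσ]; positivity
  have hτ0 : 0 < τ := by rw [hτ]; positivity
  have hψ0 : 0 ≤ ψ := by rw [hψ]; positivity
  have hΦ0 : 0 ≤ Φ := by rw [hΦ]; positivity
  have hdKb : 2 ≤ d * Kb := le_trans hd (Nat.le_mul_of_pos_right d hKb1)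
  -- the kit bracket is nonnegative under the guard
  set μb : ℕ → ℝ := fun m => W * Z ^ m * (klTowerMeasWtAt L M β U μ K d Kb j (2 * m) / klLevUnitF β M 0 m (d * Kb - 1)) with hμb
  have hμb0 : ∀ m, 0 ≤ μb m := fun m => towerMuWt_nonneg hβ U μ K d Kb j m hW0.le hZ0.le
  have hV0 : 0 ≤ towerV D τ μb := towerV_nonneg hτ0.le hμb0
  have hkit0 : 0 ≤ towerFO D σ μb (q + 1) + ∑ n' ∈ Icc 2 N, exp 1 * Φ ^ (n' - 1) * ψ ^ (q + 1) * towerS D τ μb n' (q + 1) +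
      ψ ^ (q + 1) * exp 1 * towerV D τ μb * (Φ * towerV D τ μb) ^ N / (1 - Φ * towerV D τ μb) := by
    have h1 : 0 ≤ towerFO D σ μb (q + 1) := towerFO_nonneg hσ0 hμb0 _
    have h2 : 0 ≤ ∑ n' ∈ Icc 2 N, exp 1 * Φ ^ (n' - 1) * ψ ^ (q + 1) * towerS D τ μb n' (q + 1) :=
      sum_nonneg fun n' _ => mul_nonneg (mul_nonneg (mul_nonneg (exp_pos 1).le (pow_nonneg hΦ0 _)) (pow_nonneg hψ0 _))
        (towerS_nonneg hτ0.le hμb0 n' (q + 1))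
    have h3 : 0 ≤ ψ ^ (q + 1) * exp 1 * towerV D τ μb * (Φ * towerV D τ μb) ^ N / (1 - Φ * towerV D τ μb) :=
      div_nonneg (by positivity) (sub_nonneg.2 hguard.le)
    exact add_nonneg (add_nonneg h1 h2) h3
  have hCD0 : 0 ≤ C₁ / C₂ * (max 1 (C₂ ^ 2)) ^ (q + 1) := by positivity
  -- case `j = dK_b`: the increment vanishes
  rcases Nat.eq_or_lt_of_le hKbj with hjeq | hjlt
  · have h0 : klEffectiveAction L M β U μ K klE0 j - klTowerInput L M β U μ K d Kb = 0 := by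
      rw [← hjeq]; unfold klTowerInput; exact sub_self _
    rw [h0, klWtPinnedSumAt_zero_elem, zero_div]
    exact mul_nonneg hCD0 hkit0
  · -- case `dK_b < j`: born at `F_{dK_b}` (WB1 §4, data discharged), then one jump to `F_j`
    -- the partial slice's Gram constant
    have hΛpos : 0 < klScale klE0 j := klth_klScale_pos _
    have hΛle : klScale klE0 j ≤ klScale klE0 (d * Kb) := klScale_le_klScale he.le hKbj
    have hΛle' : klScale klE0 (d * Kb) ≤ klScale klE0 (d * Kb - 1) := klScale_le_klScale he.le (by omega)
    obtain ⟨m₀, hm₀⟩ : ∃ m₀, d * Kb - 1 = m₀ + 1 := ⟨d * Kb - 2, by omega⟩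
    have hgram := (hg P R c hP hR2 hc hc3 μ hμ U hU hU4 β hβmin hβc K hfr L M hL3 hM3 m₀ (by omega)
      (klScale klE0 j) (klScale klE0 (d * Kb)) hΛpos hΛle (by rw [← hm₀]; exact hΛle')).2.1
    rw [← hm₀] at hgram
    have hκpos : 0 < Real.sqrt (Cκ * (klScale klE0 (d * Kb) / klScale klE0 (d * Kb - 1)) * (klE0 * ((8 : ℝ) ^ (d * Kb - 1))⁻¹)) := by
      have h1 : 0 < klScale klE0 (d * Kb) := klth_klScale_pos _
      have h2 : 0 < klScale klE0 (d * Kb - 1) := klth_klScale_pos _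
      exact Real.sqrt_pos.2 (by positivity)
    have hκsq : Real.sqrt (Cκ * (klScale klE0 (d * Kb) / klScale klE0 (d * Kb - 1)) * (klE0 * ((8 : ℝ) ^ (d * Kb - 1))⁻¹)) ^ 2 *
        (8 : ℝ) ^ (d * Kb) ≤ κb ^ 2 := by
      rw [gramF_sq_mul_pow_eq hCκ.le (by omega)]; exact pow_le_pow_left₀ hsq0.le hκb 2
    -- the partial slice's weighted decay rows at rate `j`
    obtain ⟨hrow, hcol⟩ := hαp G P Q c hR2 hc hc6 μ hμ U hU hU3g hcU β hβmin hβc L M hL3 hM3 n hn1 hnN hkl hhist hosc (d * Kb - 1) (by omega) j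
      (by omega) (by omega) (by omega) j (by omega)
    have hαle : Cb * ((M : ℝ) / β) / klScale klE0 j ≤ αb * (4 : ℝ) ^ (d * Kb) :=
      (div_klScale_le_bound_mul_pow (by positivity) hjd).trans (mul_le_mul_of_nonneg_right hαb (by positivity))
    have hfam : d * Kb - 1 + 1 = d * Kb := by omega
    rw [hfam] at hrow hcol
    -- the analysis overlaps at the born family
    obtain ⟨hrow', hcol'⟩ := hop G P Q c hR2 hc hc6 μ hμ U hU hU3g hcU β hβmin hβc L M hL3 hM3 n hn1 hnN hkl hhist hosc Kb (by omega) (by omega) j hKbj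
    have h2 : (2 : ℝ) ^ (d * Kb - (d * Kb - 1)) = 2 := by rw [show d * Kb - (d * Kb - 1) = 1 by omega, pow_one]
    have hcol'' : ∀ X', ∑ X'', ‖(sectorAnalysisMatrix L M β (klAnisoFamily L M β μ K klE0 (d * Kb)) *
        sectorSubMatrix L M β (bgmFatMultiplier L M klE0 β (nambuXiCT L μ K) (d * Kb - 1))) X'' X'‖ *
        klScaleWt L M β j {latticeLegPos (2 * (2 * M)) X'', latticeLegPos (2 * (2 * M)) X'} ≤ ccb := by
      intro X'
      have h := hcol' X'
      rw [h2] at h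
      exact h.trans ((le_of_eq (by ring)).trans hccb)
    -- WB1 §4 at the born family `F_{dK_b}`, every pin
    have hborn : ∀ (i' : Fin (2 * (q + 1))) (w'' : SpaceTimeIdx L M × SectorLeg (sectorCount (d * Kb))),
        klWtPinnedSumAt L M β μ K (d * Kb) j (2 * (q + 1)) (klEffectiveAction L M β U μ K klE0 j - klTowerInput L M β U μ K d Kb) i' w'' /
          klLevUnitF β M 0 (q + 1) (d * Kb) ≤
        towerFO D σ μb (q + 1) + ∑ n' ∈ Icc 2 N, exp 1 * Φ ^ (n' - 1) * ψ ^ (q + 1) * towerS D τ μb n' (q + 1) +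
          ψ ^ (q + 1) * exp 1 * towerV D τ μb * (Φ * towerV D τ μb) ^ N / (1 - Φ * towerV D τ μb) := by
      intro i' w''
      subst hW hZ' hσ hτ hψ hΦ
      exact klWtPinnedSumAt_partialIncr_le_kitStep_of_bounds (L := L) (M := M) hβ U μ K j (by omega) hKb1 le_rfl hKbj hZ hκpos hκb0 hκsq hgram
        hαb0 hαle hrow hcol hcrb0 hccb0 (fun X'' => (hrow' X'').trans hcrb) hcol'' hD hN hguard q i' w''
    -- one jump to `F_j`
    have hjump := hjp' G P Q c hc hc6 hc₃' μ hμ U hU hU3g hU₀' hcU β hβmin hβc L M hL3 hM3 n hn1 hnN hkl hhist hosc (d * Kb) j (by omega) hjn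
      (klEffectiveAction L M β U μ K klE0 j - klTowerInput L M β U μ K d Kb)
      (fun m' X hX => partialIncr_momentumConserving β U μ K d Kb j m' X hX) j le_rfl (q + 1) (by omega) _ hkit0 hborn i w
    refine hjump.trans (mul_le_mul_of_nonneg_right ?_ hkit0)
    exact mul_le_mul_of_nonneg_left (pow_le_pow_left₀ (sq_nonneg _) (le_max_right _ _) _) (by positivity)

end Summit.HubbardSuperconductivity.HubbardSuperconductivity.Theorems.EngineV8

end
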